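import Summits.Ventures.PercRepro.C041RcPortBridge
import Summits.Ventures.PercRepro.C041RcPortCountAll

/-!
# THEOREM R on skeletons, the red-connected-attachment family, WITHOUT an edge between the terminals: the count
split by the red bridge (p6, gen 24; mine-3, C-041.md §3 «Without 12, … Σ_{𝒮_rc(O)} (3g − 2) = #(Y = 1)·Φ_∨ +
#(Y = 0)·Φ_∧» and REMARK (4))

Setting of `C041RcPortBridge`.  The sources of `𝒮_rc(O)` split by the bridge flag `RedBridge O S` (a condition on the
non-port edges, invariant under the recolouring): on the part with a bridge the valid patterns are those with
`X₁ ∨ X₂` and the fibres of the admissible valid patterns have one size `N₁`; on the part without, validity is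
`X₁ ∧ X₂` and the fibre size is `N₀`; so the sum is `N₁ · Φ∨ + N₀ · Φ∧ ≥ 0` by THE LEMMA (both halves):
**`sum_goodDegree_nonneg_rc_of_bare_gen`** (per colouring) and **`sum_goodDegree_nonneg_rc_gen`** (summed over the
colourings) — mine-3's THEOREM R, «12 ∈ E or not», on every skeleton with the probe not adjacent to a terminal,
`c ≠ a, b`, `a ≠ b`.
-/

namespace PercRepro

namespace MultiGraph

open Finset ZonePort

variable {V E : Type*} {G : MultiGraph V E}

section CountGen

variable [Fintype V] [Fintype E] [DecidableEq E] {a b c : V} (hca : c ≠ a) (hcb : c ≠ b)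
  (hc : ∀ e, ¬ G.Joins e c a ∧ ¬ G.Joins e c b) (hne : a ≠ b) (O : Config E)

open Classical in
/-- The sources of `𝒮_rc(O)` with the bridge flag `y`. -/
noncomputable def rcSrcSetY (G : MultiGraph V E) (a b c : V) (O : Config E) (y : Bool) : Finset (Config E) :=
  (G.rcSrcSet a b c O).filter fun S => decide (G.RedBridge a b c O S) = y

open Classical in
/-- The fibre of a pattern on the part with bridge flag `y`. -/
noncomputable def rcFibreY (y : Bool) (x : (G.rcPort a b c O hca hcb hc).Term → Bool) : Finset (Config E) :=
  (G.rcSrcSetY a b c O y).filter fun S => rcPattern hca hcb hc S = x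

open Classical in
/-- Membership in a fibre. -/
theorem mem_rcFibreY {y : Bool} {x : (G.rcPort a b c O hca hcb hc).Term → Bool} {S : Config E} :
    S ∈ rcFibreY hca hcb hc O y x ↔
      G.IsRcSrc a b c O S ∧ decide (G.RedBridge a b c O S) = y ∧ rcPattern hca hcb hc S = x := by
  unfold rcFibreY rcSrcSetY rcSrcSet
  simp only [mem_filter, mem_univ, true_and, and_assoc]

open Classical in
/-- Membership in a fibre, coerced. -/
theorem coe_rcFibreY_mem {y : Bool} {x : (G.rcPort a b c O hca hcb hc).Term → Bool} {S : Config E} :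
    S ∈ (↑(rcFibreY hca hcb hc O y x) : Set (Config E)) ↔
      G.IsRcSrc a b c O S ∧ decide (G.RedBridge a b c O S) = y ∧ rcPattern hca hcb hc S = x := by
  rw [Finset.mem_coe]
  exact mem_rcFibreY hca hcb hc O

omit [Fintype V] [Fintype E] [DecidableEq E] in
open Classical in
/-- The bridge flag as a proposition. -/
theorem redBridge_iff_flag {y : Bool} {S : Config E} (h : decide (G.RedBridge a b c O S) = y) :
    G.RedBridge a b c O S ↔ y = true := by
  rw [← h]
  exact (decide_eq_true_iff).symm

include hne in
open Classical in
/-- **The fibres of two admissible patterns valid for the flag have the same size** (one direction). -/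
theorem card_rcFibreY_le {y : Bool} {x x' : (G.rcPort a b c O hca hcb hc).Term → Bool}
    (hx' : (G.rcPort a b c O hca hcb hc).Adm x' ∧ ValidY (G.rcPort a b c O hca hcb hc) (y = true) x') :
    (rcFibreY hca hcb hc O y x).card ≤ (rcFibreY hca hcb hc O y x').card := by
  refine card_le_card_of_injOn (rcRecolour hca hcb hc O x') ?_ ?_
  · intro S hS
    rw [coe_rcFibreY_mem] at hS ⊢
    have hval : ValidY (G.rcPort a b c O hca hcb hc) (G.RedBridge a b c O S) x' := by
      unfold ValidY at hx' ⊢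
      rw [redBridge_iff_flag O hS.2.1]
      exact hx'.2
    refine ⟨rcSrc_rcRecolour_gen hca hcb hc hne hS.1 hx'.1 hval, ?_, rcPattern_rcRecolour hca hcb hc x' S⟩
    rw [decide_eq_decide.mpr (redBridge_rcRecolour hca hcb hc hne x' S)]
    exact hS.2.1
  · intro S₁ hS₁ S₂ hS₂ heq
    rw [coe_rcFibreY_mem] at hS₁ hS₂
    have h := congrArg (rcRecolour hca hcb hc O x) heq
    rw [rcRecolour_rcRecolour hca hcb hc x x' S₁, rcRecolour_rcRecolour hca hcb hc x x' S₂] at h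
    have h1 : rcRecolour hca hcb hc O x S₁ = S₁ := by
      rw [← hS₁.2.2]
      exact rcRecolour_self hca hcb hc S₁
    have h2 : rcRecolour hca hcb hc O x S₂ = S₂ := by
      rw [← hS₂.2.2]
      exact rcRecolour_self hca hcb hc S₂
    rw [h1, h2] at h
    exact h

include hne in
open Classical in
/-- **The fibres of two admissible patterns valid for the flag have the same size.** -/
theorem card_rcFibreY_eq {y : Bool} {x x' : (G.rcPort a b c O hca hcb hc).Term → Bool}
    (hx : (G.rcPort a b c O hca hcb hc).Adm x ∧ ValidY (G.rcPort a b c O hca hcb hc) (y = true) x)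
    (hx' : (G.rcPort a b c O hca hcb hc).Adm x' ∧ ValidY (G.rcPort a b c O hca hcb hc) (y = true) x') :
    (rcFibreY hca hcb hc O y x).card = (rcFibreY hca hcb hc O y x').card :=
  le_antisymm (card_rcFibreY_le hca hcb hc hne O hx') (card_rcFibreY_le hca hcb hc hne O hx)

include hne in
open Classical in
/-- The fibre of a pattern that is not admissible and valid for the flag is empty. -/
theorem rcFibreY_eq_empty {y : Bool} {x : (G.rcPort a b c O hca hcb hc).Term → Bool}
    (hx : ¬ ((G.rcPort a b c O hca hcb hc).Adm x ∧ ValidY (G.rcPort a b c O hca hcb hc) (y = true) x)) :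
    rcFibreY hca hcb hc O y x = ∅ := by
  rw [Finset.eq_empty_iff_forall_notMem]
  intro S hS
  rw [mem_rcFibreY] at hS
  apply hx
  rw [← hS.2.2]
  have h := ((rcSrc_iff_gen hca hcb hc hne).1 hS.1).1
  refine ⟨h.1, ?_⟩
  unfold ValidY at h ⊢
  rw [← redBridge_iff_flag O hS.2.1]
  exact h.2

include hca hcb hc hne in
open Classical in
/-- **The weight sum on a part is `N · Φ`** (nonnegativity): for the flag `y`, with `Φ_y` the sum of the weights of
the admissible patterns valid for `y`. -/
theorem sum_weight_nonneg_flag (y : Bool)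
    (hΦ : 0 ≤ ∑ x : (G.rcPort a b c O hca hcb hc).Term → Bool,
      if (G.rcPort a b c O hca hcb hc).Adm x ∧ ValidY (G.rcPort a b c O hca hcb hc) (y = true) x then
        (G.rcPort a b c O hca hcb hc).weight x else 0) :
    0 ≤ ∑ S ∈ G.rcSrcSetY a b c O y, (G.rcPort a b c O hca hcb hc).weight (rcPattern hca hcb hc S) := by
  set P := G.rcPort a b c O hca hcb hc with hP
  rw [← Finset.sum_fiberwise (G.rcSrcSetY a b c O y) (rcPattern hca hcb hc)]
  have hfib : ∀ x : P.Term → Bool,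
      ∑ S ∈ (G.rcSrcSetY a b c O y).filter (fun S => rcPattern hca hcb hc S = x), P.weight (rcPattern hca hcb hc S) =
        (rcFibreY hca hcb hc O y x).card • P.weight x := by
    intro x
    rw [← Finset.sum_const]
    apply Finset.sum_congr rfl
    intro S hS
    rw [mem_filter] at hS
    rw [hS.2]
  rw [Finset.sum_congr rfl (fun x _ => by convert hfib x using 2)]
  by_cases hex : ∃ x₀ : P.Term → Bool, P.Adm x₀ ∧ ValidY P (y = true) x₀
  · obtain ⟨x₀, hx₀⟩ := hex
    have hcard : ∀ x : P.Term → Bool, (rcFibreY hca hcb hc O y x).card • P.weight x =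
        ((rcFibreY hca hcb hc O y x₀).card : ℤ) * (if P.Adm x ∧ ValidY P (y = true) x then P.weight x else 0) := by
      intro x
      by_cases hx : P.Adm x ∧ ValidY P (y = true) x
      · rw [if_pos hx, card_rcFibreY_eq hca hcb hc hne O hx hx₀, nsmul_eq_mul]
      · rw [if_neg hx, rcFibreY_eq_empty hca hcb hc hne O hx, card_empty, zero_smul, mul_zero]
    simp only [hcard]
    rw [← Finset.mul_sum]
    exact mul_nonneg (Nat.cast_nonneg _) hΦ
  · apply Finset.sum_nonneg
    intro x _
    have hx : ¬ (P.Adm x ∧ ValidY P (y = true) x) := fun h => hex ⟨x, h⟩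
    rw [rcFibreY_eq_empty hca hcb hc hne O hx, card_empty, zero_smul]

omit [Fintype V] [Fintype E] [DecidableEq E] in
/-- Validity for the flag `true` is `X₁ ∨ X₂`. -/
theorem validY_true_iff {E' : Type*} (P : ZonePort.Problem V E') (x : P.Term → Bool) :
    ValidY P (true = true) x ↔ (P.X₁ x ∨ P.X₂ x) := by
  unfold ValidY
  constructor
  · exact fun h => h.1
  · exact fun h => ⟨h, Or.inr rfl⟩

omit [Fintype V] [Fintype E] [DecidableEq E] in
/-- Validity for the flag `false` is `X₁ ∧ X₂`. -/
theorem validY_false_iff {E' : Type*} (P : ZonePort.Problem V E') (x : P.Term → Bool) :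
    ValidY P (false = true) x ↔ (P.X₁ x ∧ P.X₂ x) := by
  unfold ValidY
  constructor
  · rintro ⟨_, h | h⟩
    · exact h
    · exact absurd h Bool.false_ne_true
  · exact fun h => ⟨Or.inl h.1, Or.inl h⟩

include hca hcb hc hne in
open Classical in
/-- **THE COUNT WITHOUT AN EDGE BETWEEN THE TERMINALS — mine-3's THEOREM R per colouring, «12 ∈ E or not»**: on
every skeleton with the probe not adjacent to a terminal, `c ≠ a, b` and `a ≠ b`, for every bare colouring `O`,
`0 ≤ Σ_{S ∈ 𝒮_rc(O)} (3·[Good_a S] + 3·[Good_b S] − 2)` — the sum is `N₁ · Φ∨ + N₀ · Φ∧` by THE LEMMA. -/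
theorem sum_goodDegree_nonneg_rc_of_bare_gen :
    0 ≤ ∑ S ∈ G.rcSrcSet a b c O,
      ((if G.WalkAvoiding S (G.cluster Sᶜ a) c b then (3 : ℤ) else 0) +
        (if G.WalkAvoiding S (G.cluster Sᶜ b) c a then 3 else 0) - 2) := by
  set P := G.rcPort a b c O hca hcb hc with hP
  have hw : ∀ S ∈ G.rcSrcSet a b c O,
      ((if G.WalkAvoiding S (G.cluster Sᶜ a) c b then (3 : ℤ) else 0) +
        (if G.WalkAvoiding S (G.cluster Sᶜ b) c a then 3 else 0) - 2) = P.weight (rcPattern hca hcb hc S) := by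
    intro S hS
    unfold rcSrcSet at hS
    rw [mem_filter] at hS
    exact (weight_of_rcSrc hca hcb hc hne hS.2).symm
  rw [Finset.sum_congr rfl hw, ← Finset.sum_filter_add_sum_filter_not (G.rcSrcSet a b c O)
    (fun S => decide (G.RedBridge a b c O S) = true)]
  have hsplit : (G.rcSrcSet a b c O).filter (fun S => ¬ decide (G.RedBridge a b c O S) = true) =
      G.rcSrcSetY a b c O false := by
    unfold rcSrcSetY
    apply Finset.filter_congr
    intro S _
    cases h : decide (G.RedBridge a b c O S) <;> simp
  rw [hsplit]
  have h1 : 0 ≤ ∑ S ∈ G.rcSrcSetY a b c O true, P.weight (rcPattern hca hcb hc S) := by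
    refine sum_weight_nonneg_flag hca hcb hc hne O true ?_
    have := Problem.phiOr_nonneg P (rcPort_zonesReached hca hcb hc)
    unfold Problem.phiOr at this
    refine le_of_le_of_eq this (Finset.sum_congr rfl fun x _ => ?_)
    exact if_congr (and_congr Iff.rfl (validY_true_iff P x).symm) rfl rfl
  have h0 : 0 ≤ ∑ S ∈ G.rcSrcSetY a b c O false, P.weight (rcPattern hca hcb hc S) := by
    refine sum_weight_nonneg_flag hca hcb hc hne O false ?_
    have := Problem.phiAnd_nonneg P (rcPort_zonesReached hca hcb hc)
    unfold Problem.phiAnd at this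
    refine le_of_le_of_eq this (Finset.sum_congr rfl fun x _ => ?_)
    exact if_congr (and_congr Iff.rfl (validY_false_iff P x).symm) rfl rfl
  have h1' : (G.rcSrcSet a b c O).filter (fun S => decide (G.RedBridge a b c O S) = true) =
      G.rcSrcSetY a b c O true := rfl
  rw [h1']
  exact add_nonneg h1 h0

include hca hcb hc hne in
open Classical in
/-- **ROW C-041 `(G⅔)` on the red-connected-attachment sources, «12 ∈ E or not»** (mine-3's THEOREM R, summed
over the colourings, no edge between the terminals assumed). -/
theorem sum_goodDegree_nonneg_rc_gen :
    0 ≤ ∑ S ∈ G.rcSrcAll a b c,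
      ((if G.WalkAvoiding S (G.cluster Sᶜ a) c b then (3 : ℤ) else 0) +
        (if G.WalkAvoiding S (G.cluster Sᶜ b) c a then 3 else 0) - 2) := by
  rw [← Finset.sum_fiberwise (G.rcSrcAll a b c) (G.bareOf a b)]
  apply Finset.sum_nonneg
  intro O' _
  by_cases h : ((G.rcSrcAll a b c).filter fun S => G.bareOf a b S = O').Nonempty
  · obtain ⟨S₀, hS₀⟩ := h
    rw [mem_filter] at hS₀
    rw [← hS₀.2, filter_bareOf_eq_rc a b c S₀]
    exact sum_goodDegree_nonneg_rc_of_bare_gen hca hcb hc hne _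
  · rw [Finset.not_nonempty_iff_eq_empty.1 h, Finset.sum_empty]

end CountGen

end MultiGraph

end PercRepro
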